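import Summits.KontsevichZagierPeriods.KontsevichZagierPeriods.Theorems.RootDecompQuadraticDescentPair18HomotopyGridP2

/-! # `RootDecompQuadraticDescentPair18HomotopyGridP3` — part 3/5 of the mechanical ≤400-line split of `Grid_landing.lean` (sha256 c1ef4f0ae5c58233…)
Source: decomp-kz lens-6 g10 `Pair18HomotopyGrid.lean` (file #4; HOME/decomp-kz-lens-6/g10/, sha256 f97d8f44…; critic g5-19 CLEARED «census pair #18 = THEOREM, no hypothesis left»): hGrid_of_charts (hTh7) (hB17) : 4•[B11] − [Th7] − [B17] − 2•[PB7] ∈ KZ.relations — the nine-cell W₇-chart scissors congruence (7 cuts, 4 swaps, 4 inversions x ↦ 1/(7x) via W7_invert, linear cov); landed by census-1 g9 over the landed files #1/#2/#3 (copied prelude dropped, homonyms suffixed G, pins removed).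
Split by census-1 g9 `gen/splitlean.py`: scopes re-opened with their `open`/`variable`/`set_option` context; mathematics and declaration order unchanged. -/

set_option linter.unusedSimpArgs false
noncomputable section
open _root_.Set MvPolynomial
namespace Summit.KontsevichZagierPeriods.RootDecompQuadraticDescent.Pair18Homotopy
open Literature.NumberTheory.Transcendental
open Literature.NumberTheory.Transcendental.KZ (RFun cube)
open Summit.KontsevichZagierPeriods.RootDecompQuadraticDescent.DarkPairs (rel_reflect_rep rel_double)
section Fold
open Literature.ModelTheory.ExponentialFields (IsSemialgebraic isSemialgebraic_setOf_eval_le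
  isSemialgebraic_setOf_eval_pos isSemialgebraic_setOf_eval_nonneg isSemialgebraic_setOf_eval_eq_zero)
open _root_.Set MvPolynomial in
open Literature.NumberTheory.Transcendental in
open Literature.NumberTheory.Transcendental.KZ (RFun cube) in
open Summit.KontsevichZagierPeriods.RootDecompQuadraticDescent.DarkPairs (rel_reflect_rep rel_double) in
/-- Auxiliary step `vec2_1` (§2b): vec2 1. [bookkeeping] -/
private theorem vec2_1 (a b : ℝ) : (![a, b] : Fin 2 → ℝ) 1 = b := rfl

open _root_.Set MvPolynomial in
open Literature.NumberTheory.Transcendental in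
open Literature.NumberTheory.Transcendental.KZ (RFun cube) in
open Summit.KontsevichZagierPeriods.RootDecompQuadraticDescent.DarkPairs (rel_reflect_rep rel_double) in
/-- Auxiliary step `vec2_0` (§2b): vec2 0. [bookkeeping] -/
private theorem vec2_0 (a b : ℝ) : (![a, b] : Fin 2 → ℝ) 0 = a := rfl

open _root_.Set MvPolynomial in
open Literature.NumberTheory.Transcendental in
open Literature.NumberTheory.Transcendental.KZ (RFun cube) in
open Summit.KontsevichZagierPeriods.RootDecompQuadraticDescent.DarkPairs (rel_reflect_rep rel_double) in
/-- Auxiliary step `cube2` (§0): cube2. [bookkeeping] -/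
private theorem cube2 {x : Fin 2 → ℝ} (hx : x ∈ KZ.cube 2) : (0 ≤ x 0 ∧ x 0 ≤ 1) ∧ (0 ≤ x 1 ∧ x 1 ≤ 1) := ⟨hx 0, hx 1⟩

namespace Grid

/-- `Iv` maps `J₃ × Y` onto `J₂ × Y` and back. -/
theorem ivJ3A : KZ.of W7J3A - KZ.of W7J2A ∈ KZ.relations := by
  refine W7_invert isSemialgebraic_J3A isSemialgebraic_J2A (fun _ hz => hz.1.1) (fun _ hz => hz.1.1.1)
    (fun z hz => pos_of_sq (cube2 hz.1.1).1.1 hz.1.2) (fun w hw => by have h := hw.2; simp only [sX7c, mem_setOf_eq] at h; linarith)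
    (fun z hz => ?_) (fun w hw => ?_)
  · obtain ⟨⟨hcu, hx⟩, hy⟩ := hz
    have h0 := (cube2 hcu).1
    have h1 := (cube2 hcu).2
    have hx' : 1 ≤ 7 * (z 0 * z 0) := hx
    have ht := pos_of_sq h0.1 hx'
    have hu0 := iv_pos ht
    have hu := iv_mul ht
    refine ⟨⟨⟨?_, ?_⟩, ?_⟩, ?_⟩
    · intro i
      fin_cases i
      · show 0 ≤ 1 / (7 * z 0) ∧ 1 / (7 * z 0) ≤ 1
        exact ⟨hu0.le, iv_F4 hu0 hu (lin_of_sq h0.1 h0.2 hx')⟩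
      · exact h1
    · show 7 * (Iv z 0 * Iv z 0) ≤ 1
      rw [Iv_zero]; exact iv_F2 hu hx'
    · show 7 * (Iv z 1 * Iv z 1) ≤ 1
      rw [Iv_one]; exact hy
    · show 1 ≤ 7 * Iv z 0
      rw [Iv_zero]; exact iv_F1 hu0 hu h0.2
  · obtain ⟨⟨⟨hcu, hx⟩, hy⟩, hx'⟩ := hw
    have h0 := (cube2 hcu).1
    have h1 := (cube2 hcu).2
    have hxx : 7 * (w 0 * w 0) ≤ 1 := hx
    have hx1 : 1 ≤ 7 * w 0 := hx'
    have ht : 0 < w 0 := by linarith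
    have hu0 := iv_pos ht
    have hu := iv_mul ht
    refine ⟨⟨?_, ?_⟩, ?_⟩
    · intro i
      fin_cases i
      · show 0 ≤ 1 / (7 * w 0) ∧ 1 / (7 * w 0) ≤ 1
        exact ⟨hu0.le, iv_F4 hu0 hu hx1⟩
      · exact h1
    · show 1 ≤ 7 * (Iv w 0 * Iv w 0)
      rw [Iv_zero]; exact iv_F3 hu hxx
    · show 7 * (Iv w 1 * Iv w 1) ≤ 1
      rw [Iv_one]; exact hy
/-- Auxiliary step `ivJ33`: iv J33. [bookkeeping] -/
theorem ivJ33 : KZ.of W7J33 - KZ.of W7J23 ∈ KZ.relations := by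
  refine W7_invert isSemialgebraic_J33 isSemialgebraic_J23 (fun _ hz => hz.1.1) (fun _ hz => hz.1.1.1)
    (fun z hz => pos_of_sq (cube2 hz.1.1).1.1 hz.1.2) (fun w hw => by have h := hw.2; simp only [sX7c, mem_setOf_eq] at h; linarith)
    (fun z hz => ?_) (fun w hw => ?_)
  · obtain ⟨⟨hcu, hx⟩, hy⟩ := hz
    have h0 := (cube2 hcu).1
    have h1 := (cube2 hcu).2
    have hx' : 1 ≤ 7 * (z 0 * z 0) := hx
    have ht := pos_of_sq h0.1 hx'
    have hu0 := iv_pos ht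
    have hu := iv_mul ht
    refine ⟨⟨⟨?_, ?_⟩, ?_⟩, ?_⟩
    · intro i
      fin_cases i
      · show 0 ≤ 1 / (7 * z 0) ∧ 1 / (7 * z 0) ≤ 1
        exact ⟨hu0.le, iv_F4 hu0 hu (lin_of_sq h0.1 h0.2 hx')⟩
      · exact h1
    · show 7 * (Iv z 0 * Iv z 0) ≤ 1
      rw [Iv_zero]; exact iv_F2 hu hx'
    · show 1 ≤ 7 * (Iv z 1 * Iv z 1)
      rw [Iv_one]; exact hy
    · show 1 ≤ 7 * Iv z 0
      rw [Iv_zero]; exact iv_F1 hu0 hu h0.2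
  · obtain ⟨⟨⟨hcu, hx⟩, hy⟩, hx'⟩ := hw
    have h0 := (cube2 hcu).1
    have h1 := (cube2 hcu).2
    have hxx : 7 * (w 0 * w 0) ≤ 1 := hx
    have hx1 : 1 ≤ 7 * w 0 := hx'
    have ht : 0 < w 0 := by linarith
    have hu0 := iv_pos ht
    have hu := iv_mul ht
    refine ⟨⟨?_, ?_⟩, ?_⟩
    · intro i
      fin_cases i
      · show 0 ≤ 1 / (7 * w 0) ∧ 1 / (7 * w 0) ≤ 1
        exact ⟨hu0.le, iv_F4 hu0 hu hx1⟩
      · exact h1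
    · show 1 ≤ 7 * (Iv w 0 * Iv w 0)
      rw [Iv_zero]; exact iv_F3 hu hxx
    · show 1 ≤ 7 * (Iv w 1 * Iv w 1)
      rw [Iv_one]; exact hy
/-- Auxiliary step `ivJ32`: iv J32. [bookkeeping] -/
theorem ivJ32 : KZ.of W7J32 - KZ.of W7C22 ∈ KZ.relations := by
  refine W7_invert isSemialgebraic_J32 isSemialgebraic_C22 (fun _ hz => hz.1.1.1) (fun _ hz => hz.1.1.1.1)
    (fun z hz => pos_of_sq (cube2 hz.1.1.1).1.1 hz.1.1.2)
    (fun w hw => by have h := hw.1.2; simp only [sX7c, mem_setOf_eq] at h; linarith)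
    (fun z hz => ?_) (fun w hw => ?_)
  · obtain ⟨⟨⟨hcu, hx⟩, hy⟩, hy'⟩ := hz
    have h0 := (cube2 hcu).1
    have h1 := (cube2 hcu).2
    have hx' : 1 ≤ 7 * (z 0 * z 0) := hx
    have ht := pos_of_sq h0.1 hx'
    have hu0 := iv_pos ht
    have hu := iv_mul ht
    refine ⟨⟨⟨⟨?_, ?_⟩, ?_⟩, ?_⟩, ?_⟩
    · intro i
      fin_cases i
      · show 0 ≤ 1 / (7 * z 0) ∧ 1 / (7 * z 0) ≤ 1
        exact ⟨hu0.le, iv_F4 hu0 hu (lin_of_sq h0.1 h0.2 hx')⟩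
      · exact h1
    · show 7 * (Iv z 0 * Iv z 0) ≤ 1
      rw [Iv_zero]; exact iv_F2 hu hx'
    · show 7 * (Iv z 1 * Iv z 1) ≤ 1
      rw [Iv_one]; exact hy
    · show 1 ≤ 7 * Iv z 0
      rw [Iv_zero]; exact iv_F1 hu0 hu h0.2
    · show 1 ≤ 7 * Iv z 1
      rw [Iv_one]; exact hy'
  · obtain ⟨⟨⟨⟨hcu, hx⟩, hy⟩, hx'⟩, hy'⟩ := hw
    have h0 := (cube2 hcu).1
    have h1 := (cube2 hcu).2
    have hxx : 7 * (w 0 * w 0) ≤ 1 := hx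
    have hx1 : 1 ≤ 7 * w 0 := hx'
    have ht : 0 < w 0 := by linarith
    have hu0 := iv_pos ht
    have hu := iv_mul ht
    refine ⟨⟨⟨?_, ?_⟩, ?_⟩, ?_⟩
    · intro i
      fin_cases i
      · show 0 ≤ 1 / (7 * w 0) ∧ 1 / (7 * w 0) ≤ 1
        exact ⟨hu0.le, iv_F4 hu0 hu hx1⟩
      · exact h1
    · show 1 ≤ 7 * (Iv w 0 * Iv w 0)
      rw [Iv_zero]; exact iv_F3 hu hxx
    · show 7 * (Iv w 1 * Iv w 1) ≤ 1
      rw [Iv_one]; exact hy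
    · show 1 ≤ 7 * Iv w 1
      rw [Iv_one]; exact hy'
/-- Auxiliary step `ivJ31`: iv J31. [bookkeeping] -/
theorem ivJ31 : KZ.of W7J31 - KZ.of W7C21 ∈ KZ.relations := by
  refine W7_invert isSemialgebraic_J31 isSemialgebraic_C21 (fun _ hz => hz.1.1) (fun _ hz => hz.1.1.1.1)
    (fun z hz => pos_of_sq (cube2 hz.1.1).1.1 hz.1.2)
    (fun w hw => by have h := hw.1.2; simp only [sX7c, mem_setOf_eq] at h; linarith)
    (fun z hz => ?_) (fun w hw => ?_)
  · obtain ⟨⟨hcu, hx⟩, hy'⟩ := hz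
    have h0 := (cube2 hcu).1
    have h1 := (cube2 hcu).2
    have hx' : 1 ≤ 7 * (z 0 * z 0) := hx
    have hy1 : 7 * z 1 ≤ 1 := hy'
    have ht := pos_of_sq h0.1 hx'
    have hu0 := iv_pos ht
    have hu := iv_mul ht
    refine ⟨⟨⟨⟨?_, ?_⟩, ?_⟩, ?_⟩, ?_⟩
    · intro i
      fin_cases i
      · show 0 ≤ 1 / (7 * z 0) ∧ 1 / (7 * z 0) ≤ 1
        exact ⟨hu0.le, iv_F4 hu0 hu (lin_of_sq h0.1 h0.2 hx')⟩
      · exact h1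
    · show 7 * (Iv z 0 * Iv z 0) ≤ 1
      rw [Iv_zero]; exact iv_F2 hu hx'
    · show 7 * (Iv z 1 * Iv z 1) ≤ 1
      rw [Iv_one]; exact sq_of_lin h1.1 hy1
    · show 1 ≤ 7 * Iv z 0
      rw [Iv_zero]; exact iv_F1 hu0 hu h0.2
    · show 7 * Iv z 1 ≤ 1
      rw [Iv_one]; exact hy1
  · obtain ⟨⟨⟨⟨hcu, hx⟩, hy⟩, hx'⟩, hy'⟩ := hw
    have h0 := (cube2 hcu).1
    have h1 := (cube2 hcu).2
    have hxx : 7 * (w 0 * w 0) ≤ 1 := hx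
    have hx1 : 1 ≤ 7 * w 0 := hx'
    have ht : 0 < w 0 := by linarith
    have hu0 := iv_pos ht
    have hu := iv_mul ht
    refine ⟨⟨?_, ?_⟩, ?_⟩
    · intro i
      fin_cases i
      · show 0 ≤ 1 / (7 * w 0) ∧ 1 / (7 * w 0) ≤ 1
        exact ⟨hu0.le, iv_F4 hu0 hu hx1⟩
      · exact h1
    · show 1 ≤ 7 * (Iv w 0 * Iv w 0)
      rw [Iv_zero]; exact iv_F3 hu hxx
    · show 7 * Iv w 1 ≤ 1
      rw [Iv_one]; exact hy'

/-! ### `[PB7] ≡ [W₇ | J₁ × [0,1]]` by `x ↦ x/7` -/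
/-- Auxiliary definition `Sc7`: Sc7. [bookkeeping] -/
def Sc7 (z : Fin 2 → ℝ) : Fin 2 → ℝ := ![(7:ℝ)⁻¹ * z 0, z 1]
/-- Auxiliary step `Sc7_zero`: Sc7 zero. [bookkeeping] -/
theorem Sc7_zero (z : Fin 2 → ℝ) : Sc7 z 0 = (7:ℝ)⁻¹ * z 0 := rfl
/-- Auxiliary step `Sc7_one`: Sc7 one. [bookkeeping] -/
theorem Sc7_one (z : Fin 2 → ℝ) : Sc7 z 1 = z 1 := rfl

set_option maxHeartbeats 1600000 in
/-- Auxiliary step `PB7_C1`: PB7 C1. [bookkeeping] -/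
theorem PB7_C1 : KZ.of PB7.rep - KZ.of W7C1 ∈ KZ.relations := by
  let Mz : Matrix (Fin 2) (Fin 2) ℝ := !![(7:ℝ)⁻¹, 0; 0, 1]
  let Φ' : (Fin 2 → ℝ) → (Fin 2 → ℝ) →L[ℝ] (Fin 2 → ℝ) := fun _ =>
    LinearMap.toContinuousLinearMap (Matrix.toLin' Mz)
  have hΦ'ap : ∀ z w, Φ' z w = ![(7:ℝ)⁻¹ * w 0, w 1] := by
    intro z w; funext i
    fin_cases i <;> simp [Φ', Mz, Matrix.toLin'_apply, Matrix.mulVec, dotProduct, Fin.sum_univ_two]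
  have hdet : ∀ z, (Φ' z).det = (7:ℝ)⁻¹ := by
    intro z
    unfold ContinuousLinearMap.det
    simp [Φ', LinearMap.det_toLin', Mz, Matrix.det_fin_two]
  have hdetpos : (0:ℝ) < (7:ℝ)⁻¹ := by positivity
  have hdom : W7C1.domain = Sc7 '' PB7.rep.domain := by
    simp only [W7C1, KZ.IntegralRep.domain_restrict, RFun.rep_domain]
    ext w
    constructor
    · rintro ⟨hwc, hx⟩
      have h0 := (cube2 hwc).1
      have h1 := (cube2 hwc).2
      have hx' : 7 * w 0 ≤ 1 := hx
      refine ⟨![7 * w 0, w 1], ?_, ?_⟩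
      · intro i
        fin_cases i
        · show 0 ≤ 7 * w 0 ∧ 7 * w 0 ≤ 1
          exact ⟨by linarith [h0.1], hx'⟩
        · exact h1
      · funext i
        fin_cases i
        · show (7:ℝ)⁻¹ * (7 * w 0) = w 0
          field_simp
        · rfl
    · rintro ⟨z, hzc, rfl⟩
      have h0 := (cube2 hzc).1
      have h1 := (cube2 hzc).2
      refine ⟨?_, ?_⟩
      · intro i
        fin_cases i
        · show 0 ≤ (7:ℝ)⁻¹ * z 0 ∧ (7:ℝ)⁻¹ * z 0 ≤ 1
          exact ⟨mul_nonneg (by positivity) h0.1, by nlinarith [h0.2]⟩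
        · exact h1
      · show 7 * Sc7 z 0 ≤ 1
        rw [Sc7_zero]; nlinarith [h0.2]
  refine KZ.changeOfVariablesRel_subset_relations ⟨2, PB7.rep, W7C1, Sc7, Φ', ?_, ?_, ?_, hdom, ?_, rfl⟩
  · have hsd : IsSemialgebraic ℚ PB7.rep.domain := PB7.rep.isSemialgebraic_domain
    refine (isSemialgebraicMapOn_iff_forall_holds hsd).mpr fun i => ?_
    fin_cases i
    · exact (isSemialgebraicFunOn_aeval hsd (C 7⁻¹ * X 0)).congr fun z _ => by
        simp only [Sc7, Fin.zero_eta, Matrix.cons_val_zero, map_mul, aeval_C, aeval_X, eq_ratCast, Rat.cast_inv,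
          Rat.cast_ofNat]
    · exact (isSemialgebraicFunOn_aeval hsd (X 1)).congr fun z _ => by
        simp only [Sc7, Fin.mk_one, Matrix.cons_val_one, Matrix.head_cons, Matrix.cons_val_fin_one, aeval_X]
  · intro z hz
    have hA := hasFDerivAt_apply (𝕜 := ℝ) 0 z
    have hB := hasFDerivAt_apply (𝕜 := ℝ) 1 z
    have hA' := hA.const_mul (7:ℝ)⁻¹
    have hpi : HasFDerivAt Sc7 (Φ' z) z := by
      rw [hasFDerivAt_pi']
      intro i
      fin_cases i
      · refine (hA'.congr_fderiv ?_).congr_of_eventuallyEq (Filter.Eventually.of_forall fun y => ?_)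
        · ext w
          simp [hΦ'ap]
        · simp only [Fin.zero_eta, Sc7_zero]
      · refine (hB.congr_fderiv ?_).congr_of_eventuallyEq (Filter.Eventually.of_forall fun y => ?_)
        · ext w
          simp [hΦ'ap]
        · simp only [Fin.mk_one, Sc7_one]
    exact hpi.hasFDerivWithinAt
  · intro z₁ hz₁ z₂ hz₂ heq
    have e0 : (7:ℝ)⁻¹ * z₁ 0 = (7:ℝ)⁻¹ * z₂ 0 := by simpa [Sc7] using congrFun heq 0
    have e1 : z₁ 1 = z₂ 1 := by simpa [Sc7] using congrFun heq 1
    funext i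
    fin_cases i
    · exact mul_left_cancel₀ (by positivity : (7:ℝ)⁻¹ ≠ 0) e0
    · exact e1
  · intro z hz
    rw [hdet z, abs_of_pos hdetpos]
    simp only [W7C1, KZ.IntegralRep.integrand_restrict, RFun.rep_integrand]
    simp only [PB7, PB7Den, W7, W7Den, RFun.fn, Sc7, map_add, map_sub, map_mul, aeval_C, aeval_X, eq_ratCast,
      Rat.cast_one, Rat.cast_ofNat, vec2_0, vec2_1, Matrix.cons_val_zero, Matrix.cons_val_one, Matrix.head_cons]
    have h1 : (0:ℝ) < 7 + z 0 * z 0 := by nlinarith [mul_self_nonneg (z 0)]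
    have h2 : (0:ℝ) < 1 + 7 * z 1 * z 1 := by nlinarith [mul_self_nonneg (z 1)]
    have h3 : (0:ℝ) < 1 + 7 * ((7:ℝ)⁻¹ * z 0) * ((7:ℝ)⁻¹ * z 0) := by nlinarith [mul_self_nonneg ((7:ℝ)⁻¹ * z 0)]
    have h1ne := h1.ne'
    have h2ne := h2.ne'
    have h3ne := h3.ne'
    field_simp

/-! ### `[B11] ≡ [W₇ | A × A]` — the `U = 1` copy of §19u (`(π/4)²`), then the scaling `z ↦ z/√7` -/
-- [P2 l.4683, verbatim]
/-- Auxiliary definition `W14`: W14. [bookkeeping] -/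
def W14 : RFun 2 := ⟨C 14, W7Den, fun x _ => (W7Den_pos x).ne'⟩
/-- Auxiliary definition `W1Den`: W1 Den. [bookkeeping] -/
def W1Den : MvPolynomial (Fin 2) ℚ := (C 1 + X 0 * X 0) * (C 1 + X 1 * X 1)
/-- Auxiliary step `W1Den_pos`: W1 Den pos. [bookkeeping] -/
theorem W1Den_pos (x : Fin 2 → ℝ) : 0 < aeval x W1Den := by
  simp only [W1Den, map_add, map_mul, aeval_C, aeval_X, eq_ratCast, Rat.cast_one]
  exact mul_pos (by nlinarith [mul_self_nonneg (x 0)]) (by nlinarith [mul_self_nonneg (x 1)])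
/-- `W₂ := [□², 2/((1+x²)(1+y²))]`. -/
def W2 : RFun 2 := ⟨C 2, W1Den, fun x _ => (W1Den_pos x).ne'⟩
/-- Auxiliary definition `Bq1P`: Bq1 P. [bookkeeping] -/
def Bq1P : KZ.IntegralRep 2 := (Bq 1 zero_le_one).rep.restrict SqP0 isSemialgebraic_SqP0 (fun _ hz => hz.1)
/-- Auxiliary definition `W2Tri`: W2 Tri. [bookkeeping] -/
def W2Tri : KZ.IntegralRep 2 := W2.rep.restrict TriG isSemialgebraic_TriG (fun _ hz => hz.1)
/-- Auxiliary definition `W2TriP`: W2 Tri P. [bookkeeping] -/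
def W2TriP : KZ.IntegralRep 2 := W2Tri.restrict TriPG isSemialgebraic_TriPG (fun _ hz => hz.1)
/-- Auxiliary definition `W14TriB`: W14 Tri B. [bookkeeping] -/
def W14TriB : KZ.IntegralRep 2 := W14.rep.restrict TriB isSemialgebraic_TriB (fun _ hz => hz.1.1.1)

end Grid
end Fold
end Summit.KontsevichZagierPeriods.RootDecompQuadraticDescent.Pair18Homotopy
end
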